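import Mathlib
import Literature.AlgebraicGeometry.Resolution.AffineBlowupCartier
import Summits.ResolutionOfSingularities.ResolutionOfSingularities.Theorems.WildQuotientsWildQuotientResolutionTwoBlocksChartAlgebra

/-!
# An invariant centre gives an ideal sheaf stable under the action on `Spec` (programme T, input of S4-scheme)

(crux stmt-ResolutionOfSingularities-15640 `WildQuotients.WildQuotientResolution`, line `Sketch`,
programme «INSTANTIATE T1» = `𝔸⁴/(J₂ ⊕ J₂)` of chain w45c; [OURS · L1 W4.5c] — NOT a statement of
any manuscript.)

The hypothesis `hρ : ∀ g, I.comap (ρ g).hom = I` of `IsBlowup.liftAction`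
(`Literature.AlgebraicGeometry.Resolution.BlowupsEquivariant`) for the centre of a blow-up of an
affine scheme with a group action: for a group `G` acting on a ring `R` by ring automorphisms,
the action `ρ g = Spec (g⁻¹)` on `Spec R` (`AffineQuotient.exists_specAction`, characterised by
`hρ`) and a `G`-invariant ideal `I` (`g • I = I`), the ideal sheaf `affineBlowup.idealSheaf I` of
`I` on `Spec R` is `ρ g`-stable (`idealSheaf_comap_specAction`; via
`comap_ofIdealTop_SpecMap`). For `σ = J₂ ⊕ J₂` on `k[x₀,…,x₃]` and the centre `(x₀, x₂)`
(`TwoBlocks.stub_twoBlocks_map_centre`): `TwoBlocks.smul_centre_eq`, `TwoBlocks.idealSheaf_centre_comap`.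
-/

-- single-problem summit: the doubled namespace component `ResolutionOfSingularities` is forced
set_option linter.dupNamespace false

noncomputable section

universe u

open CategoryTheory AlgebraicGeometry TopologicalSpace MvPolynomial
open scoped Pointwise
open Literature.AlgebraicGeometry.Resolution

namespace Summit.ResolutionOfSingularities.ResolutionOfSingularities.Theorems.WildQuotientResolution.AffineQuotient

/-- **A `G`-invariant ideal gives a `ρ`-stable ideal sheaf on `Spec R`.** For `ρ g = Spec (g⁻¹)`
and `g • I = I` for all `g`: `(affineBlowup.idealSheaf I).comap (ρ g).hom = affineBlowup.idealSheaf I`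
— the hypothesis of `IsBlowup.liftAction` for the centre `I`. [folklore] -/
theorem idealSheaf_comap_specAction {R : Type u} [CommRing R] {G : Type u} [Group G]
    [MulSemiringAction G R] (ρ : G →* Aut (Spec (CommRingCat.of R)))
    (hρ : ∀ g : G, (ρ g).hom =
      Spec.map (CommRingCat.ofHom ((MulSemiringAction.toRingEquiv G R g⁻¹ : R ≃+* R) : R →+* R)))
    (I : Ideal R) (hI : ∀ g : G, g • I = I) (g : G) :
    (affineBlowup.idealSheaf I).comap (ρ g).hom = affineBlowup.idealSheaf I := by
  rw [hρ, affineBlowup.idealSheaf, comap_ofIdealTop_SpecMap]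
  congr 2
  -- `I.map (g⁻¹) = g⁻¹ • I = I`
  exact hI g⁻¹

end Summit.ResolutionOfSingularities.ResolutionOfSingularities.Theorems.WildQuotientResolution.AffineQuotient

namespace Summit.ResolutionOfSingularities.ResolutionOfSingularities.Theorems.WildQuotientResolution.TwoBlocks

/-- **The centre `(x₀, x₂)` is invariant under `⟨σ⟩`** for `σ` with `σ x₀ = x₀`, `σ x₂ = x₂`
(`stub_twoBlocks_map_centre`, extended from `σ` to its powers). [folklore] -/
theorem smul_centre_eq (k : Type) [Field k]
    (σ : MvPolynomial (Fin 4) k ≃ₐ[k] MvPolynomial (Fin 4) k)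
    (h0 : σ (X 0) = X 0) (h2 : σ (X 2) = X 2) (g : Subgroup.zpowers σ) :
    g • (Ideal.span {X 0, X 2} : Ideal (MvPolynomial (Fin 4) k)) = Ideal.span {X 0, X 2} := by
  have hσ : σ • (Ideal.span {X 0, X 2} : Ideal (MvPolynomial (Fin 4) k)) = Ideal.span {X 0, X 2} :=
    stub_twoBlocks_map_centre k σ h0 h2
  obtain ⟨j, hj⟩ := Subgroup.mem_zpowers_iff.mp g.2
  change (g : MvPolynomial (Fin 4) k ≃ₐ[k] MvPolynomial (Fin 4) k) •
      (Ideal.span {X 0, X 2} : Ideal (MvPolynomial (Fin 4) k)) = Ideal.span {X 0, X 2}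
  rw [← hj]
  exact MulAction.fixedBy_subset_fixedBy_zpow (Ideal (MvPolynomial (Fin 4) k)) σ j hσ

/-- **The ideal sheaf of the centre `(x₀, x₂)` on `𝔸⁴` is stable under the action of `⟨σ⟩`**
(`ρ g = Spec (g⁻¹)`), i.e. the hypothesis `hρ` of `IsBlowup.liftAction` for
`Bl_{(x₀,x₂)} 𝔸⁴ = affineBlowup (Ideal.span {X 0, X 2})`. [folklore] -/
theorem idealSheaf_centre_comap (k : Type) [Field k]
    (σ : MvPolynomial (Fin 4) k ≃ₐ[k] MvPolynomial (Fin 4) k)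
    (h0 : σ (X 0) = X 0) (h2 : σ (X 2) = X 2)
    (ρ : ↥(Subgroup.zpowers σ) →* Aut (Spec (CommRingCat.of (MvPolynomial (Fin 4) k))))
    (hρ : ∀ g : ↥(Subgroup.zpowers σ), (ρ g).hom = Spec.map (CommRingCat.ofHom
      ((MulSemiringAction.toRingEquiv (↥(Subgroup.zpowers σ)) (MvPolynomial (Fin 4) k) g⁻¹ :
        MvPolynomial (Fin 4) k ≃+* MvPolynomial (Fin 4) k) :
          MvPolynomial (Fin 4) k →+* MvPolynomial (Fin 4) k)))
    (g : ↥(Subgroup.zpowers σ)) :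
    (affineBlowup.idealSheaf (Ideal.span {X 0, X 2} : Ideal (MvPolynomial (Fin 4) k))).comap
        (ρ g).hom =
      affineBlowup.idealSheaf (Ideal.span {X 0, X 2} : Ideal (MvPolynomial (Fin 4) k)) :=
  AffineQuotient.idealSheaf_comap_specAction ρ hρ _ (smul_centre_eq k σ h0 h2) g

end Summit.ResolutionOfSingularities.ResolutionOfSingularities.Theorems.WildQuotientResolution.TwoBlocks

end
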